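import Summits.Ventures.PercRepro.C026TwoCut

/-!
# A mark-free two-terminal gadget: the local-event count (p5, gen 15)

mine-3 (`proofs/MINE3-TWOCUT.md`, INBOX 18:46Z, Theorem C′ / B″): with the virtual-edge dictionary of
C026TwoCut, every event of the marks' open and closed connectivities (`Local Φ M`) is counted by
`[G] = n00·[G₁] + n10·[G₁ + st] + n11·[G₁/st]` (**`card_twocut`**), the `n_xy` being the gadget's type counts
(open join `x`, closed join `y`; `n01 = n10` by complement symmetry, `card_gadget_mixed`).
-/

namespace PercRepro

open Finset

namespace MultiGraph

section TwoCutCount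

variable {V E : Type*} {G : MultiGraph V E}

/-- **The virtual-edge dictionary (closed)**: the closed connectivity factors the same way, with the virtual edge
closed-open iff the gadget joins `s` to `t` by closed edges. -/
theorem conn_compl_twocut_iff {s t : V} {side : E → Bool} (hg : G.IsGluing s t t side) {x y : V}
    (hx : x = s ∨ x = t ∨ G.OnSide side true x) (hy : y = s ∨ y = t ∨ G.OnSide side true y)
    (ω : Config E) :
    G.Conn ωᶜ x y ↔
      (G.virt side s t).Conn
        (extendOpt (G.gadgetJoin₂ side s t (sideRestrict ω side false)ᶜ) (sideRestrict ω side true)ᶜ) x y := by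
  rw [conn_twocut_iff hg hx hy ωᶜ, gadgetJoin_compl, sideRestrict_compl]

/-- An event of the marks' connectivities: `Φ` depends only on the open and closed connectivity relations
restricted to the marks `M`. -/
def Local (Φ : (V → V → Prop) → (V → V → Prop) → Prop) (M : Set V) : Prop :=
  ∀ (R₁ R₂ R₁' R₂' : V → V → Prop), (∀ m ∈ M, ∀ m' ∈ M, (R₁ m m' ↔ R₂ m m')) →
    (∀ m ∈ M, ∀ m' ∈ M, (R₁' m m' ↔ R₂' m m')) → (Φ R₁ R₁' ↔ Φ R₂ R₂')

open Classical in
/-- The count of a local event over the virtual-edge graph splits over the two states of the virtual edge. -/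
theorem card_virt_split [Fintype E] (side : E → Bool) (s t : V)
    (Φ : (V → V → Prop) → (V → V → Prop) → Prop) :
    (univ.filter fun τ : Config (Option {e // side e = true}) =>
        Φ ((G.virt side s t).Conn τ) ((G.virt side s t).Conn τᶜ)).card =
      (univ.filter fun ω₁ : Config {e // side e = true} =>
          Φ ((G.virt side s t).Conn (extendOpt false ω₁)) ((G.virt side s t).Conn (extendOpt false ω₁)ᶜ)).card +
        (univ.filter fun ω₁ : Config {e // side e = true} =>
          Φ ((G.virt side s t).Conn (extendOpt true ω₁)) ((G.virt side s t).Conn (extendOpt true ω₁)ᶜ)).card := by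
  convert card_filter_option (E := {e // side e = true})
    (fun τ : Config (Option {e // side e = true}) =>
      Φ ((G.virt side s t).Conn τ) ((G.virt side s t).Conn τᶜ)) using 4

open Classical in
/-- Complement symmetry on the gadget: the two mixed types are equinumerous. -/
theorem card_gadget_mixed [Fintype E] (side : E → Bool) (s t : V) :
    (univ.filter fun ω₂ : Config {e // side e = false} =>
        G.gadgetJoin₂ side s t ω₂ = false ∧ G.gadgetJoin₂ side s t ω₂ᶜ = true).card =
      (univ.filter fun ω₂ : Config {e // side e = false} =>
        G.gadgetJoin₂ side s t ω₂ = true ∧ G.gadgetJoin₂ side s t ω₂ᶜ = false).card := by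
  refine Finset.card_nbij' (fun ω => ωᶜ) (fun ω => ωᶜ) ?_ ?_ ?_ ?_
  · intro ω hω
    simp only [Finset.coe_filter, Finset.mem_univ, true_and, Set.mem_setOf_eq, compl_compl] at hω ⊢
    exact ⟨hω.2, hω.1⟩
  · intro ω hω
    simp only [Finset.coe_filter, Finset.mem_univ, true_and, Set.mem_setOf_eq, compl_compl] at hω ⊢
    exact ⟨hω.2, hω.1⟩
  · intro ω _
    exact compl_compl ω
  · intro ω _
    exact compl_compl ω

open Classical in
/-- **Theorem B″ / C′ for local events** (mine-3, `proofs/MINE3-TWOCUT.md`): for a mark-free gadget glued at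
`s, t` and an event `Φ` of the connectivities of marks `M` on the other side (`M ∌ s, t`),
`[G] = n00·[G₁] + n10·[G₁ + st] + n11·[G₁/st]`, with `n_xy` the gadget's counts of configurations whose
open join of `s, t` is `x` and whose closed join is `y` (`n01 = n10` by complement symmetry). -/
theorem card_twocut [Fintype E] {s t : V} {side : E → Bool} (hg : G.IsGluing s t t side) (hts : t ≠ s)
    (Φ : (V → V → Prop) → (V → V → Prop) → Prop) {M : Set V}
    (hM : ∀ m ∈ M, m ≠ s ∧ G.OnSide side true m) (hΦ : Local Φ M) :
    (univ.filter fun ω : Config E => Φ (G.Conn ω) (G.Conn ωᶜ)).card =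
      (univ.filter fun ω₂ : Config {e // side e = false} =>
          G.gadgetJoin₂ side s t ω₂ = false ∧ G.gadgetJoin₂ side s t ω₂ᶜ = false).card *
        (univ.filter fun ω₁ : Config {e // side e = true} =>
          Φ ((G.part side true).Conn ω₁) ((G.part side true).Conn ω₁ᶜ)).card +
      (univ.filter fun ω₂ : Config {e // side e = false} =>
          G.gadgetJoin₂ side s t ω₂ = true ∧ G.gadgetJoin₂ side s t ω₂ᶜ = false).card *
        (univ.filter fun τ : Config (Option {e // side e = true}) =>
          Φ ((G.virt side s t).Conn τ) ((G.virt side s t).Conn τᶜ)).card +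
      (univ.filter fun ω₂ : Config {e // side e = false} =>
          G.gadgetJoin₂ side s t ω₂ = true ∧ G.gadgetJoin₂ side s t ω₂ᶜ = true).card *
        (univ.filter fun ω₁ : Config {e // side e = true} =>
          Φ (((G.part side true).contract s t).Conn ω₁)
            (((G.part side true).contract s t).Conn ω₁ᶜ)).card := by
  -- the event of `G`, read through the virtual edge
  have hdict : ∀ ω : Config E, Φ (G.Conn ω) (G.Conn ωᶜ) ↔
      Φ ((G.virt side s t).Conn
          (extendOpt (G.gadgetJoin₂ side s t (sideRestrict ω side false)) (sideRestrict ω side true)))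
        ((G.virt side s t).Conn
          (extendOpt (G.gadgetJoin₂ side s t (sideRestrict ω side false)ᶜ) (sideRestrict ω side true)ᶜ)) := by
    intro ω
    refine hΦ _ _ _ _ ?_ ?_
    · intro m hm m' hm'
      exact conn_twocut_iff hg (Or.inr (Or.inr (hM m hm).2)) (Or.inr (Or.inr (hM m' hm').2)) ω
    · intro m hm m' hm'
      exact conn_compl_twocut_iff hg (Or.inr (Or.inr (hM m hm).2)) (Or.inr (Or.inr (hM m' hm').2)) ω
  -- one type of the gadget: a product count
  have htype : ∀ x y : Bool, (univ.filter fun ω : Config E => Φ (G.Conn ω) (G.Conn ωᶜ) ∧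
      G.gadgetJoin₂ side s t (sideRestrict ω side false) = x ∧
        G.gadgetJoin₂ side s t (sideRestrict ω side false)ᶜ = y).card =
      (univ.filter fun ω₁ : Config {e // side e = true} =>
          Φ ((G.virt side s t).Conn (extendOpt x ω₁)) ((G.virt side s t).Conn (extendOpt y ω₁ᶜ))).card *
        (univ.filter fun ω₂ : Config {e // side e = false} =>
          G.gadgetJoin₂ side s t ω₂ = x ∧ G.gadgetJoin₂ side s t ω₂ᶜ = y).card := by
    intro x y
    have e1 : (univ.filter fun ω : Config E => Φ (G.Conn ω) (G.Conn ωᶜ) ∧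
        G.gadgetJoin₂ side s t (sideRestrict ω side false) = x ∧
          G.gadgetJoin₂ side s t (sideRestrict ω side false)ᶜ = y) =
        (univ.filter fun ω : Config E =>
          Φ ((G.virt side s t).Conn (extendOpt x (sideRestrict ω side true)))
            ((G.virt side s t).Conn (extendOpt y (sideRestrict ω side true)ᶜ)) ∧
          (G.gadgetJoin₂ side s t (sideRestrict ω side false) = x ∧
            G.gadgetJoin₂ side s t (sideRestrict ω side false)ᶜ = y)) := by
      refine Finset.filter_congr fun ω _ => ?_
      constructor
      · rintro ⟨hΦω, hx, hy⟩
        rw [hdict, hx, hy] at hΦω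
        exact ⟨hΦω, hx, hy⟩
      · rintro ⟨hΦω, hx, hy⟩
        refine ⟨?_, hx, hy⟩
        rw [hdict, hx, hy]
        exact hΦω
    rw [e1]
    convert card_filter_cut side
      (fun ω₁ : Config {e // side e = true} =>
        Φ ((G.virt side s t).Conn (extendOpt x ω₁)) ((G.virt side s t).Conn (extendOpt y ω₁ᶜ)))
      (fun ω₂ : Config {e // side e = false} =>
        G.gadgetJoin₂ side s t ω₂ = x ∧ G.gadgetJoin₂ side s t ω₂ᶜ = y) using 4
  -- the four types partition the cube
  have hsplit : (univ.filter fun ω : Config E => Φ (G.Conn ω) (G.Conn ωᶜ)).card =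
      ∑ p ∈ (univ : Finset (Bool × Bool)), (univ.filter fun ω : Config E =>
        Φ (G.Conn ω) (G.Conn ωᶜ) ∧ G.gadgetJoin₂ side s t (sideRestrict ω side false) = p.1 ∧
          G.gadgetJoin₂ side s t (sideRestrict ω side false)ᶜ = p.2).card := by
    rw [Finset.card_eq_sum_card_fiberwise
      (f := fun ω => (G.gadgetJoin₂ side s t (sideRestrict ω side false),
        G.gadgetJoin₂ side s t (sideRestrict ω side false)ᶜ)) (t := univ)
      (fun _ _ => Finset.mem_univ _)]
    refine Finset.sum_congr rfl fun p _ => ?_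
    congr 1
    ext ω
    simp only [Finset.mem_filter, Finset.mem_univ, true_and, Prod.ext_iff]
  -- the mixed types are the two slices of the virtual-edge graph
  have h10 : (univ.filter fun ω₁ : Config {e // side e = true} =>
      Φ ((G.virt side s t).Conn (extendOpt true ω₁)) ((G.virt side s t).Conn (extendOpt false ω₁ᶜ))).card =
      (univ.filter fun ω₁ : Config {e // side e = true} =>
        Φ ((G.virt side s t).Conn (extendOpt true ω₁)) ((G.virt side s t).Conn (extendOpt true ω₁)ᶜ)).card := by
    refine congrArg Finset.card (Finset.filter_congr fun ω₁ _ => ?_)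
    rw [compl_extendOpt]
    rfl
  have h01 : (univ.filter fun ω₁ : Config {e // side e = true} =>
      Φ ((G.virt side s t).Conn (extendOpt false ω₁)) ((G.virt side s t).Conn (extendOpt true ω₁ᶜ))).card =
      (univ.filter fun ω₁ : Config {e // side e = true} =>
        Φ ((G.virt side s t).Conn (extendOpt false ω₁)) ((G.virt side s t).Conn (extendOpt false ω₁)ᶜ)).card := by
    refine congrArg Finset.card (Finset.filter_congr fun ω₁ _ => ?_)
    rw [compl_extendOpt]
    rfl
  -- the types `(false, false)` and `(true, true)` are `G₁` and `G₁ / st`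
  have h00 : (univ.filter fun ω₁ : Config {e // side e = true} =>
      Φ ((G.virt side s t).Conn (extendOpt false ω₁)) ((G.virt side s t).Conn (extendOpt false ω₁ᶜ))).card =
      (univ.filter fun ω₁ : Config {e // side e = true} =>
        Φ ((G.part side true).Conn ω₁) ((G.part side true).Conn ω₁ᶜ)).card := by
    refine congrArg Finset.card (Finset.filter_congr fun ω₁ _ => hΦ _ _ _ _ ?_ ?_)
    · intro m _ m' _
      exact conn_addEdge_closed_iff
    · intro m _ m' _
      exact conn_addEdge_closed_iff
  have h11 : (univ.filter fun ω₁ : Config {e // side e = true} =>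
      Φ ((G.virt side s t).Conn (extendOpt true ω₁)) ((G.virt side s t).Conn (extendOpt true ω₁ᶜ))).card =
      (univ.filter fun ω₁ : Config {e // side e = true} =>
        Φ (((G.part side true).contract s t).Conn ω₁) (((G.part side true).contract s t).Conn ω₁ᶜ)).card := by
    refine congrArg Finset.card (Finset.filter_congr fun ω₁ _ => hΦ _ _ _ _ ?_ ?_)
    · intro m hm m' hm'
      exact conn_addEdge_open_iff_contract hts (hM m hm).1 (hM m' hm').1
    · intro m hm m' hm'
      exact conn_addEdge_open_iff_contract hts (hM m hm).1 (hM m' hm').1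
  rw [hsplit, ← Finset.univ_product_univ, Finset.sum_product, Fintype.sum_bool, Fintype.sum_bool,
    Fintype.sum_bool, htype, htype, htype, htype, h00, h11, h10, h01, card_virt_split, card_gadget_mixed]
  ring

end TwoCutCount

end MultiGraph

end PercRepro
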